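import Literature.NumberTheory.Automorphic.Liu2021.Prop413MultLeOneOfAsPrinted
import Mathlib.LinearAlgebra.Projection
import HarnessLib

/-!
# [Liu 2021] Prop. 4.13 with multiplicity one ⟹ HODGE PURITY of the summands `ω(μ,ε,χ)` in `H¹_{B,τ'}(A_∞, ℂ)`

Y. Liu, *Fourier–Jacobi cycles and arithmetic relative trace formula*, Camb. J. Math. **9** (2021) 1–147 = arXiv:2102.11518
[Liu2021]; TeX source `FJcycle.tex` (md5 `6db49a74122d2cb0f224fa1b39488a0c`; `l. NNNN` = its lines), §4.2: l. 2074
(«the Hecke correspondences provide a homomorphism `𝔾(𝔸_F^∞) → Aut_E(A_∞)`»), l. 2076–2081 (`H¹_{B,τ'}(A_∞, ℂ)`), Prop. 4.13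
(ll. 2113–2119) and its proof (ll. 2121–2146: «`π_{∞1} ≃ ω_{n−1,1}^{m_1,±,1}` … `H¹(𝔤, K_G; π_∞)` is of dimension `1`», l. 2139–2141;
«the dimension of `H¹_{B,τ'}(A_∞, ℂ)[ω(μ,ε,χ)]` is `1`», l. 2145), App. D Lemma D.2 (2) (l. 5284: «only `ω_{n−1,1}^{−1,−,0}` (resp.
`ω_{n−1,1}^{1,+,0}`) is isomorphic to `π^{1,0}_{n−1,1}` (resp. `π^{0,1}_{n−1,1}`)»), Remark 4.14 (l. 2149: for `n = 3`, [GR91, Rog92]).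

## What this file records, and why

The printed proof of Prop. 4.13 determines, for every admissible weight-one triple `(μ,ε,χ)`, the archimedean component
`π_∞` of the unique automorphic `π` with `π^∞ ≃ ω(μ,ε,χ)` contributing to the Albanese, with `dim H¹(𝔤, K_G; π_∞) = 1`
(l. 2139–2141); by Lemma D.2 (2) that one-dimensional `(𝔤,K)`-cohomology is of Hodge type `(1,0)` OR of type `(0,1)` (which one
is decided by the sign `±` = the sign of `i^{−1} τ_1^+(e)`, l. 2141 — the ORIENTATION datum).  Consequently the `ω(μ,ε,χ)`-isotypic
part of `H¹_{B,τ'}(A_∞, ℂ) = H^{1,0} ⊕ H^{0,1}` is PURE: contained in `H^{1,0}` or contained in `H^{0,1}`.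

This file types the ORIENTATION-FREE («symmetric») form of that purity as a predicate `HodgeSplitting.IsPure` on the datum of
Prop. 4.13 (`Prop413Data`, nothing new posited except the two Hodge pieces, a ⟨CARRIER⟩ structure `HodgeSplitting`), and PROVES
it (class K) from the printed multiplicity-one sentence l. 2145 (tree record `Prop413Data.MultOneAsPrinted`, itself DERIVED in
`Prop413MultLeOneOfAsPrinted` from Prop. 4.13 AS PRINTED + Def. 4.11 + pairwise non-isomorphy) and the `𝔾(𝔸_F^∞)`-stability of
the Hodge splitting (l. 2074: Hecke correspondences act through `E`-endomorphisms of `A_∞`, hence through morphisms of Hodge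
structures on `H¹_B` — a field of the carrier): an intertwiner `j : ω_t → H¹_{B,τ'}` composed with the (equivariant) projection
onto `H^{1,0}` along `H^{0,1}` is again an intertwiner, hence `c • j` by multiplicity `≤ 1`; `c = 0` puts `range j` inside
`H^{0,1}`, `c ≠ 0` inside `H^{1,0}`.  Two consequences used by the pub-hodgecm2 cell's «¬hJ» lane (ROW P, pub-hodgecm2/INBOX
l. 18456 ∕ l. 18524): the KEYED purity «every intertwiner from `ω_t` lands in `H^{1,0}`» from ONE non-zero `(1,0)`-witness
(`range_le_H10_of_apply_mem`), and the vanishing of every equivariant endomorphism of `H¹_{B,τ'}` that SWAPS the two Hodge pieces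
(`comp_eq_zero_of_swap`, `eq_zero_of_swap_of_asPrinted` — the shape of «complex conjugation of points followed by an algebraic
map», which is how a component-Albanese record at the conjugate complex instance would act).

§1 is the representation-theoretic core over any field (no Liu objects); §2 the wrappers on `Prop413Data`.
Everything is a definition by explicit formula or a theorem; NO named fact, no instance, no `sorry`; nothing about Liu's
objects is constructed or asserted (`IsPure` is a predicate on the consumer's datum; `∀ P S, S.IsPure` is not claimed).
HC_CM is NOT proved here or anywhere by this file.  Seat prover-pub-hodgecm2-nothj-p3-g0-0 (¬hJ lane, Literature cell), 2026-08-24.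

NOT here: the keyed form «`ω(μ,ε,χ) ⊆ H^{1,0}_{τ'}` iff `τ' ∈ Φ_μ`» (Thm. 4.15 ∕ Lemma D.2 (2) with the sign bookkeeping — the
orientation question), Prop. 4.13 itself, the Hodge decomposition of a consumer's tower (the consumer supplies `HodgeSplitting`).

## References
* [Liu2021] §4.2 l. 2074, ll. 2076–2081; Prop. 4.13 (ll. 2113–2119) with proof ll. 2139–2146; App. D Lemma D.2 (2) (l. 5284);
  Rem. 4.14 (l. 2149); Def. 4.11; Thm. 4.18 (2).
* Tree: `Liu2021.Prop413AsPrinted`, `Liu2021.Prop413Data.MultOneAsPrinted`, `Liu2021.Prop413Data.multOneAsPrinted_of_asPrinted`,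
  `Liu2021.Prop413Data.rank_intertwiningMap_rhoAt_le_one_of_asPrinted` (this directory); Mathlib `Submodule.projection`,
  `LinearMap.IsIdempotentElem.commute_iff`, `Representation.IntertwiningMap`.
-/

noncomputable section

open NumberField

namespace Literature.NumberTheory.Automorphic.Liu2021

/-! ## §1  Intertwiners out of a multiplicity-`≤ 1` source respect an invariant splitting of the target -/

namespace RankOneIntertwiner

variable {k G V W : Type*} [Field k] [Monoid G] [AddCommGroup V] [Module k V] [AddCommGroup W] [Module k W]
  {ρ : Representation k G V} {σ : Representation k G W}

/-- If `Hom_G(ρ, σ)` has `k`-rank `≤ 1` and `j ≠ 0` is an intertwiner, every intertwiner `ψ : ρ → σ` is `c • j`.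
(Linear algebra; the shape in which multiplicity one is consumed.) [folklore] -/
private theorem exists_eq_smul (h : Module.rank k (Representation.IntertwiningMap ρ σ) ≤ 1)
    {j : Representation.IntertwiningMap ρ σ} (hj : j ≠ 0) (ψ : Representation.IntertwiningMap ρ σ) :
    ∃ c : k, ψ = c • j := by
  obtain ⟨v₀, hv₀⟩ := rank_le_one_iff.mp h
  obtain ⟨r, hr⟩ := hv₀ j
  obtain ⟨s, hs⟩ := hv₀ ψ
  have hr0 : r ≠ 0 := by
    rintro rfl
    exact hj (by rw [← hr, zero_smul])
  refine ⟨s * r⁻¹, ?_⟩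
  rw [← hs, ← hr, smul_smul, mul_assoc, inv_mul_cancel₀ hr0, mul_one]

variable (σ) in
/-- **The projection onto an invariant submodule along an invariant complement is an intertwining endomorphism.**
For `σ`-stable `p`, `q` with `p ⊕ q = W`, Mathlib's `p.projection q` commutes with every `σ g`
(`LinearMap.IsIdempotentElem.commute_iff`). [folklore] -/
def projIntertwining (p q : Submodule k W) (hpq : IsCompl p q)
    (hp : ∀ g : G, p ∈ Module.End.invtSubmodule (σ g)) (hq : ∀ g : G, q ∈ Module.End.invtSubmodule (σ g)) :
    Representation.IntertwiningMap σ σ where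
  toLinearMap := p.projection q hpq
  isIntertwining' g := by
    have hc : Commute (p.projection q hpq) (σ g) :=
      (LinearMap.IsIdempotentElem.commute_iff (T := σ g) (Submodule.isIdempotentElem_projection hpq)).2
        ⟨by rw [Submodule.range_projection]; exact hp g, by rw [Submodule.ker_projection]; exact hq g⟩
    exact hc.eq

/-- The intertwining projection is `p.projection q` as a linear map. [folklore] -/
@[simp] private theorem projIntertwining_apply (p q : Submodule k W) (hpq : IsCompl p q)
    (hp : ∀ g : G, p ∈ Module.End.invtSubmodule (σ g)) (hq : ∀ g : G, q ∈ Module.End.invtSubmodule (σ g)) (w : W) :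
    projIntertwining σ p q hpq hp hq w = p.projection q hpq w := rfl

/-- **Purity.**  If `Hom_G(ρ, σ)` has rank `≤ 1` and `W = p ⊕ q` is a `σ`-stable splitting, the range of EVERY intertwiner
`j : ρ → σ` lies inside `p` or inside `q`: `π_p ∘ j` is an intertwiner, hence `c • j`; `c = 0` gives `range j ≤ ker π_p = q`,
`c ≠ 0` gives `j v = c⁻¹ π_p (j v) ∈ p`. [folklore] -/
private theorem range_le_or_range_le (h : Module.rank k (Representation.IntertwiningMap ρ σ) ≤ 1)
    (p q : Submodule k W) (hpq : IsCompl p q)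
    (hp : ∀ g : G, p ∈ Module.End.invtSubmodule (σ g)) (hq : ∀ g : G, q ∈ Module.End.invtSubmodule (σ g))
    (j : Representation.IntertwiningMap ρ σ) :
    LinearMap.range j.toLinearMap ≤ p ∨ LinearMap.range j.toLinearMap ≤ q := by
  by_cases hj : j = 0
  · subst hj
    left
    rw [Representation.IntertwiningMap.zero_toLinearMap, LinearMap.range_zero]
    exact bot_le
  obtain ⟨c, hc⟩ := exists_eq_smul h hj ((projIntertwining σ p q hpq hp hq).comp j)
  by_cases hc0 : c = 0
  · -- `π_p ∘ j = 0`: every `j v` lies in `ker π_p = q`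
    right
    rintro _ ⟨v, rfl⟩
    have hv : p.projection q hpq (j v) = 0 := by
      have := congrArg (fun f : Representation.IntertwiningMap ρ σ => f v) hc
      simpa [hc0] using this
    exact (Submodule.projection_apply_eq_zero_iff hpq).1 hv
  · -- `π_p ∘ j = c • j`, `c ≠ 0`: `j v = c⁻¹ • π_p (j v) ∈ p`
    left
    rintro _ ⟨v, rfl⟩
    have hv : p.projection q hpq (j v) = c • j v := by
      have := congrArg (fun f : Representation.IntertwiningMap ρ σ => f v) hc
      simpa using this
    have : j v = c⁻¹ • p.projection q hpq (j v) := by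
      rw [hv, smul_smul, inv_mul_cancel₀ hc0, one_smul]
    rw [Representation.IntertwiningMap.toLinearMap_apply, this]
    exact p.smul_mem _ (Submodule.projection_apply_mem hpq _)

/-- **Keyed purity from one witness.**  Under the same hypotheses, if SOME intertwiner `j₀ : ρ → σ` takes a non-zero value in
`p`, then EVERY intertwiner `j : ρ → σ` has `range j ≤ p` (`j = c • j₀`, and `range j₀ ≤ q` is excluded by `p ⊓ q = ⊥`).
[folklore] -/
private theorem range_le_of_apply_mem (h : Module.rank k (Representation.IntertwiningMap ρ σ) ≤ 1)
    (p q : Submodule k W) (hpq : IsCompl p q)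
    (hp : ∀ g : G, p ∈ Module.End.invtSubmodule (σ g)) (hq : ∀ g : G, q ∈ Module.End.invtSubmodule (σ g))
    (j₀ : Representation.IntertwiningMap ρ σ) (v : V) (hv : j₀ v ∈ p) (hv0 : j₀ v ≠ 0)
    (j : Representation.IntertwiningMap ρ σ) :
    LinearMap.range j.toLinearMap ≤ p := by
  have hj₀ : j₀ ≠ 0 := by
    rintro rfl
    exact hv0 rfl
  have h₀ : LinearMap.range j₀.toLinearMap ≤ p := by
    rcases range_le_or_range_le h p q hpq hp hq j₀ with h₀ | h₀
    · exact h₀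
    · exfalso
      have hq' : j₀ v ∈ q := h₀ ⟨v, rfl⟩
      exact hv0 ((Submodule.mem_bot k).1 (hpq.disjoint.le_bot ⟨hv, hq'⟩))
  obtain ⟨c, rfl⟩ := exists_eq_smul h hj₀ j
  rintro _ ⟨w, rfl⟩
  rw [Representation.IntertwiningMap.toLinearMap_apply, Representation.IntertwiningMap.smul_apply]
  exact p.smul_mem c (h₀ ⟨w, rfl⟩)

/-- **An equivariant endomorphism that SWAPS the two pieces kills every intertwiner from a multiplicity-`≤ 1` source.**
If `E : σ → σ` is intertwining with `E(p) ⊆ q`, `E(q) ⊆ p`, then `E ∘ j = 0` for every intertwiner `j : ρ → σ`: by purity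
`range j ≤ p` (say), `E ∘ j = c • j`, and `c • j v ∈ p ⊓ q = ⊥`. [folklore] -/
private theorem comp_eq_zero_of_swap (h : Module.rank k (Representation.IntertwiningMap ρ σ) ≤ 1)
    (p q : Submodule k W) (hpq : IsCompl p q)
    (hp : ∀ g : G, p ∈ Module.End.invtSubmodule (σ g)) (hq : ∀ g : G, q ∈ Module.End.invtSubmodule (σ g))
    (E : Representation.IntertwiningMap σ σ) (hEp : ∀ x ∈ p, E x ∈ q) (hEq : ∀ x ∈ q, E x ∈ p)
    (j : Representation.IntertwiningMap ρ σ) : E.comp j = 0 := by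
  by_cases hj : j = 0
  · subst hj
    exact Representation.IntertwiningMap.ext (by
      rw [Representation.IntertwiningMap.comp_toLinearMap, Representation.IntertwiningMap.zero_toLinearMap,
        LinearMap.comp_zero])
  obtain ⟨c, hc⟩ := exists_eq_smul h hj (E.comp j)
  -- in either case `c • j v ∈ p ⊓ q`
  have key : ∀ v : V, c • j v = 0 := by
    intro v
    have hcv : E (j v) = c • j v := by
      have := congrArg (fun f : Representation.IntertwiningMap ρ σ => f v) hc
      simpa using this
    rcases range_le_or_range_le h p q hpq hp hq j with hr | hr
    · have h1 : E (j v) ∈ q := hEp _ (hr ⟨v, rfl⟩)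
      have h2 : c • j v ∈ p := p.smul_mem c (hr ⟨v, rfl⟩)
      rw [hcv] at h1
      exact (Submodule.mem_bot k).1 (hpq.disjoint.le_bot ⟨h2, h1⟩)
    · have h1 : E (j v) ∈ p := hEq _ (hr ⟨v, rfl⟩)
      have h2 : c • j v ∈ q := q.smul_mem c (hr ⟨v, rfl⟩)
      rw [hcv] at h1
      exact (Submodule.mem_bot k).1 (hpq.disjoint.le_bot ⟨h1, h2⟩)
  rw [hc]
  exact Representation.IntertwiningMap.ext (LinearMap.ext fun v => by
    rw [Representation.IntertwiningMap.toLinearMap_apply, Representation.IntertwiningMap.smul_apply, key v,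
      Representation.IntertwiningMap.zero_toLinearMap, LinearMap.zero_apply])

end RankOneIntertwiner

/-! ## §2  At the datum of [Liu2021, Prop. 4.13]: the Hodge splitting of `H¹_{B,τ'}(A_∞, ℂ)` and its purity -/

namespace Prop413Data

variable {F E : Type} [Field F] [NumberField F] [IsTotallyReal F] [Field E] [NumberField E] [Algebra F E]
  [IsTotallyComplex E] [Algebra.IsQuadraticExtension F E] {P : Prop413Data F E} {τ' : E →+* ℂ}

variable (P τ') in
/-- ⟨CARRIER⟩ **The Hodge splitting of `H¹_{B,τ'}(A_∞, ℂ)`** (l. 2076–2081: Betti cohomology of the complex abelian varieties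
`A_K ⊗_{E,τ'} ℂ`, `A_K = Alb_{X_K}`, in the colimit over `K`): two `ℂ`-submodules `H^{1,0}`, `H^{0,1}` of the posited module
`P.HB τ'`, complementary (the Hodge decomposition in degree `1`), each stable under `𝔾(𝔸_F^∞)` — l. 2074 «the Hecke correspondences
provide a homomorphism `𝔾(𝔸_F^∞) → Aut_E(A_∞)`»: the group acts through `E`-homomorphisms of abelian varieties, i.e. through
morphisms of `ℚ`-Hodge structures on `H¹_B`.  DATA supplied by a consumer from its own model (e.g. the pieces `(1,0)` ∕ `(0,1)` of
its tower of `H¹(P_Γ; ℂ)`); nothing is asserted by the structure. [cite: Liu2021, §4.2 l. 2074 and ll. 2076–2081] -/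
structure HodgeSplitting : Type where
  /-- ⟨CARRIER⟩ `H^{1,0} ⊆ H¹_{B,τ'}(A_∞, ℂ)`. -/
  H10 : Submodule ℂ (P.HB τ')
  /-- ⟨CARRIER⟩ `H^{0,1} ⊆ H¹_{B,τ'}(A_∞, ℂ)`. -/
  H01 : Submodule ℂ (P.HB τ')
  /-- `H¹ = H^{1,0} ⊕ H^{0,1}` (Hodge decomposition in degree one). -/
  isCompl : IsCompl H10 H01
  /-- `H^{1,0}` is `𝔾(𝔸_F^∞)`-stable (the action is by morphisms of Hodge structures, l. 2074). -/
  H10_mem_invtSubmodule : ∀ g : P.G, H10 ∈ Module.End.invtSubmodule (P.rhoB τ' g)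
  /-- `H^{0,1}` is `𝔾(𝔸_F^∞)`-stable. -/
  H01_mem_invtSubmodule : ∀ g : P.G, H01 ∈ Module.End.invtSubmodule (P.rhoB τ' g)

namespace HodgeSplitting

variable (S : P.HodgeSplitting τ')

/-- **HODGE PURITY of the oscillator summands, ORIENTATION-FREE form** (the predicate).  For every adèlic oscillator triple
`t = (μ,ε,χ)` with `μ` of weight one and `ε` `μ`-admissible, every `ℂ[𝔾(𝔸_F^∞)]`-linear map `ω(μ,ε,χ) → H¹_{B,τ'}(A_∞, ℂ)` has
its image inside `H^{1,0}` OR inside `H^{0,1}`.  This is what the printed proof of Prop. 4.13 yields once the sign is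
forgotten: «we have `π_{∞1} ≃ ω_{n−1,1}^{m_1,±,1}` … where … the sign in the parameter is the sign of `i^{−1}τ_i^+(e)` … Moreover,
`H¹(𝔤, K_G; π_∞)` is of dimension `1`» (l. 2139–2141) with App. D Lemma D.2 (2) «only `ω_{n−1,1}^{−1,−,0}` (resp. `ω_{n−1,1}^{1,+,0}`)
is isomorphic to `π^{1,0}_{n−1,1}` (resp. `π^{0,1}_{n−1,1}`)» (l. 5284); for `n = 3` also [GR91], [Rog92] (Rem. 4.14).  A
predicate on the consumer's datum and splitting — PROVED below from multiplicity one (`isPure_of_multOne`), not posited.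
[cite: Liu2021, Prop. 4.13, proof l. 2139–2146; App. D Lemma D.2 (2)] -/
def IsPure : Prop :=
  ∀ (t : P.AdmTriple) (j : Representation.IntertwiningMap (P.rhoAt t) (P.rhoB τ')),
    LinearMap.range j.toLinearMap ≤ S.H10 ∨ LinearMap.range j.toLinearMap ≤ S.H01

/-- **The projection `H¹_{B,τ'} → H^{1,0} ↪ H¹_{B,τ'}` along `H^{0,1}` is `𝔾(𝔸_F^∞)`-equivariant.**
[cite: Liu2021, §4.2 l. 2074] -/
def proj10 : Representation.IntertwiningMap (P.rhoB τ') (P.rhoB τ') :=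
  RankOneIntertwiner.projIntertwining (P.rhoB τ') S.H10 S.H01 S.isCompl S.H10_mem_invtSubmodule S.H01_mem_invtSubmodule

/-- **Purity from a rank bound** (the working form): if `dim_ℂ Hom_{ℂ[𝔾]}(ω_t, H¹_{B,τ'}) ≤ 1` then every intertwiner from `ω_t`
lands in `H^{1,0}` or in `H^{0,1}`. [cite: Liu2021, Prop. 4.13, proof l. 2145] -/
theorem range_le_or_range_le_of_rank_le_one (t : P.AdmTriple)
    (h : Module.rank ℂ (Representation.IntertwiningMap (P.rhoAt t) (P.rhoB τ')) ≤ 1)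
    (j : Representation.IntertwiningMap (P.rhoAt t) (P.rhoB τ')) :
    LinearMap.range j.toLinearMap ≤ S.H10 ∨ LinearMap.range j.toLinearMap ≤ S.H01 :=
  RankOneIntertwiner.range_le_or_range_le h S.H10 S.H01 S.isCompl S.H10_mem_invtSubmodule S.H01_mem_invtSubmodule j

/-- **[Liu2021, proof of Prop. 4.13 (l. 2139–2146) with Lemma D.2 (2)] — PURITY DERIVED from the multiplicity-one sentence
l. 2145** (`MultOneAsPrinted`) and the `𝔾(𝔸_F^∞)`-stability of the Hodge splitting: for `n ≥ 3`, `S.IsPure`.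
[cite: Liu2021, Prop. 4.13, proof l. 2145; App. D Lemma D.2 (2)] -/
theorem isPure_of_multOne (h : P.MultOneAsPrinted) (hn : 3 ≤ P.n) : S.IsPure := fun t j =>
  S.range_le_or_range_le_of_rank_le_one t (h.rank_intertwiningMap_le_one hn τ' t) j

/-- **PURITY FROM THE STATEMENT of Prop. 4.13** + Def. 4.11's adjectives + pairwise non-isomorphy of the summands (Thm. 4.18 (2),
App. D Lemma D.1 (3)) + one compact open subgroup — through `rank_intertwiningMap_rhoAt_le_one_of_asPrinted`.
[cite: Liu2021, Prop. 4.13 (ll. 2113–2119) with proof ll. 2139–2146; Def. 4.11; Thm. 4.18 (2); App. D Lemma D.1 (3), D.2 (2)] -/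
theorem isPure_of_asPrinted (h : Liu2021.Prop413AsPrinted P) (hn : 3 ≤ P.n)
    (h411 : ∀ t : P.AdmTriple,
      IsIrreducibleOrZero (P.rhoAt t) ∧ IsSmoothRep (P.rhoAt t) ∧ IsAdmissibleRep (P.rhoAt t))
    (hsep : ∀ s t : P.AdmTriple, Nontrivial (P.omegaAt s) →
      (∃ f : P.omegaAt s ≃ₗ[ℂ] P.omegaAt t, ∀ (g : P.G) (v : P.omegaAt s), f (P.rhoAt s g v) = P.rhoAt t g (f v)) →
      s = t)
    (hK : ∃ K : Subgroup P.G, IsOpenCompact K) : S.IsPure := fun t j =>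
  S.range_le_or_range_le_of_rank_le_one t (rank_intertwiningMap_rhoAt_le_one_of_asPrinted h hn τ' h411 hsep hK t) j

/-- **KEYED purity from ONE `(1,0)`-witness**: if some intertwiner `j₀ : ω_t → H¹_{B,τ'}` takes a non-zero value in `H^{1,0}`
(e.g. a holomorphic theta class in the `ω_t`-block), then EVERY intertwiner from `ω_t` has image inside `H^{1,0}` — the
orientation of the block is read off the witness, not off a sign convention. [cite: Liu2021, Prop. 4.13, proof l. 2145] -/
theorem range_le_H10_of_apply_mem (h : P.MultOneAsPrinted) (hn : 3 ≤ P.n) (t : P.AdmTriple)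
    (j₀ : Representation.IntertwiningMap (P.rhoAt t) (P.rhoB τ')) (v : P.omegaAt t) (hv : j₀ v ∈ S.H10) (hv0 : j₀ v ≠ 0)
    (j : Representation.IntertwiningMap (P.rhoAt t) (P.rhoB τ')) : LinearMap.range j.toLinearMap ≤ S.H10 :=
  RankOneIntertwiner.range_le_of_apply_mem (h.rank_intertwiningMap_le_one hn τ' t) S.H10 S.H01 S.isCompl
    S.H10_mem_invtSubmodule S.H01_mem_invtSubmodule j₀ v hv hv0 j

/-- The mirror statement: one non-zero `(0,1)`-witness puts every intertwiner from `ω_t` inside `H^{0,1}`.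
[cite: Liu2021, Prop. 4.13, proof l. 2145] -/
theorem range_le_H01_of_apply_mem (h : P.MultOneAsPrinted) (hn : 3 ≤ P.n) (t : P.AdmTriple)
    (j₀ : Representation.IntertwiningMap (P.rhoAt t) (P.rhoB τ')) (v : P.omegaAt t) (hv : j₀ v ∈ S.H01) (hv0 : j₀ v ≠ 0)
    (j : Representation.IntertwiningMap (P.rhoAt t) (P.rhoB τ')) : LinearMap.range j.toLinearMap ≤ S.H01 :=
  RankOneIntertwiner.range_le_of_apply_mem (h.rank_intertwiningMap_le_one hn τ' t) S.H01 S.H10 S.isCompl.symm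
    S.H01_mem_invtSubmodule S.H10_mem_invtSubmodule j₀ v hv hv0 j

/-- **A `𝔾(𝔸_F^∞)`-equivariant endomorphism of `H¹_{B,τ'}(A_∞, ℂ)` that SWAPS the Hodge pieces kills every oscillator
summand**: `E ∘ j = 0` for every intertwiner `j : ω_t → H¹_{B,τ'}`. [cite: Liu2021, Prop. 4.13, proof l. 2145] -/
theorem comp_eq_zero_of_swap (h : P.MultOneAsPrinted) (hn : 3 ≤ P.n)
    (Esw : Representation.IntertwiningMap (P.rhoB τ') (P.rhoB τ'))
    (h10 : ∀ x ∈ S.H10, Esw x ∈ S.H01) (h01 : ∀ x ∈ S.H01, Esw x ∈ S.H10)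
    (t : P.AdmTriple) (j : Representation.IntertwiningMap (P.rhoAt t) (P.rhoB τ')) : Esw.comp j = 0 :=
  RankOneIntertwiner.comp_eq_zero_of_swap (h.rank_intertwiningMap_le_one hn τ' t) S.H10 S.H01 S.isCompl
    S.H10_mem_invtSubmodule S.H01_mem_invtSubmodule Esw h10 h01 j

/-- **… and is therefore ZERO**, because by Prop. 4.13 AS PRINTED the images of the summands `ω_t` span `H¹_{B,τ'}(A_∞, ℂ)`
(`Φ⁻¹ ∘ ι_t` is an intertwiner for every admissible `t`).  This is the algebraic heart of the obstruction to a component-Albanese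
record at the complex-conjugate instance: such a record would induce exactly a piece-swapping equivariant map.
[cite: Liu2021, Prop. 4.13 (ll. 2113–2119) and proof l. 2145] -/
theorem eq_zero_of_swap_of_asPrinted (h413 : Liu2021.Prop413AsPrinted P) (h : P.MultOneAsPrinted) (hn : 3 ≤ P.n)
    (Esw : Representation.IntertwiningMap (P.rhoB τ') (P.rhoB τ'))
    (h10 : ∀ x ∈ S.H10, Esw x ∈ S.H01) (h01 : ∀ x ∈ S.H01, Esw x ∈ S.H10) : Esw = 0 := by
  classical
  obtain ⟨Φ, hΦ⟩ := h413 hn τ'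
  -- the embedding of the `t`-th summand, as an intertwiner
  have hj : ∀ t : P.AdmTriple, ∀ (g : P.G) (v : P.omegaAt t),
      (Φ.symm.toLinearMap ∘ₗ DirectSum.lof ℂ P.AdmTriple P.omegaAt t) (P.rhoAt t g v) =
        P.rhoB τ' g ((Φ.symm.toLinearMap ∘ₗ DirectSum.lof ℂ P.AdmTriple P.omegaAt t) v) := by
    intro t g v
    apply Φ.injective
    simp only [LinearMap.coe_comp, LinearEquiv.coe_coe, Function.comp_apply, LinearEquiv.apply_symm_apply]
    refine DFinsupp.ext fun s => ?_
    rw [hΦ g (Φ.symm (DirectSum.lof ℂ P.AdmTriple P.omegaAt t v)) s, LinearEquiv.apply_symm_apply]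
    by_cases hst : s = t
    · subst hst
      simp only [DirectSum.lof_eq_of, DirectSum.of_eq_same]
    · have h1 : (DirectSum.lof ℂ P.AdmTriple P.omegaAt t v) s = 0 := by
        rw [DirectSum.lof_eq_of, DirectSum.of_eq_of_ne _ _ _ hst]
      have h2 : (DirectSum.lof ℂ P.AdmTriple P.omegaAt t (P.rhoAt t g v)) s = 0 := by
        rw [DirectSum.lof_eq_of, DirectSum.of_eq_of_ne _ _ _ hst]
      rw [h1, h2, map_zero]
  let jt : ∀ t : P.AdmTriple, Representation.IntertwiningMap (P.rhoAt t) (P.rhoB τ') := fun t =>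
    (Φ.symm.toLinearMap ∘ₗ DirectSum.lof ℂ P.AdmTriple P.omegaAt t).intertwiningMap_of_isIntertwiningMap
      (P.rhoAt t) (P.rhoB τ') (hj t)
  have hzero : ∀ t, Esw.comp (jt t) = 0 := fun t => S.comp_eq_zero_of_swap h hn Esw h10 h01 t (jt t)
  -- `Esw ∘ Φ⁻¹ = 0` on the direct sum, by extensionality on the summands
  have hsum : Esw.toLinearMap ∘ₗ Φ.symm.toLinearMap = 0 := by
    refine DirectSum.linearMap_ext ℂ fun t => ?_
    rw [LinearMap.zero_comp, LinearMap.comp_assoc]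
    have := congrArg Representation.IntertwiningMap.toLinearMap (hzero t)
    rw [Representation.IntertwiningMap.comp_toLinearMap, Representation.IntertwiningMap.zero_toLinearMap] at this
    exact this
  refine Representation.IntertwiningMap.ext (LinearMap.ext fun x => ?_)
  have := congrArg (fun f : (DirectSum P.AdmTriple fun t => P.omegaAt t) →ₗ[ℂ] P.HB τ' => f (Φ x)) hsum
  simpa using this

end HodgeSplitting

end Prop413Data

end Literature.NumberTheory.Automorphic.Liu2021

end
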